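import Summits.QuantumFields.BalabanUV.Beta.D1BFx.FineHessianReflection
import Literature.MathematicalPhysics.QuantumFieldTheory.Balaban1983to89.Beta.KernelWard
import Literature.MathematicalPhysics.QuantumFieldTheory.Balaban1983to89.Beta.KernelRepresentationSummable

/-!
# `BalabanUV.Beta.D1BFx.FineHessianWard` — road «BF-x» for binder row D1, sub-leaf A4-leg (Ward socket): THE WARD-ROW INPUT `hrow` OF
# THE A4 / K-R5 ENDs FROM THE JET-LEVEL GAUGE-COVARIANCE LAWS (W1)/(W2) OF THE PRIMITIVE DATA — an2's `KernelWard.ward_hess` at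
# blocking `1` + an2's `KernelRepresentationSummable.hasSum_zero_of_divFree`; and the ENDs of both reduced sectors with EVERY
# composite-kernel hypothesis replaced by sockets on leg / stencils / tables / gauge generator

HONEST DEPENDENCY (page 1, mandatory): continuum YM on T⁴ ⇐ BetaPertH ∧ nine spine estimates (0/9 proved); BetaPertH ⇐ (D1) ∧ (D4) ∧
CAP+tail; G-an2-4 gates asym, D1 and NE2/3/4.  HONEST FRAMING (cell contract, verbatim): «discharging `BetaPertH` makes Bałaban's UV
stability UNCONDITIONAL — a real constructive-QFT result; it is NOT the continuum limit and NOT the Clay problem.»  No definition; [folklore]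
bookkeeping BY NAME.  No `def … : Prop`, no citation, no printed statement as hypothesis; 0 binders of the hR root touched; nothing of D1 /
BetaPertH discharged.  The laws (W1)/(W2) and the relabelling laws are HYPOTHESES on the road's objects (T1 `Ga` / T2 `Ggh`, T4–T6
stencils and tables, the gauge generator `X`): whether Bałaban's jets satisfy them is the content of nodes J/K-R2/CHECK-N0, NOT asserted.
ABSOLUTE RULE (cell charter, verbatim): «No internally-minted statement may enter as a cited fact. Every hypothesis is either
kernel-proved in this package or a verbatim quotation of a PUBLISHED theorem with page reference. The manuscript(s) under audit are NOT
citable for their own disputed steps — they are the thing under adjudication; programme-internal (2001/route/tribunal) claims are never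
citable.»

WHY (skeleton v1.4 node R5, verbatim: «the MAIN TERM needs (T0) `Σ_w P(b,b+w) = 0` (zero-momentum Ward identity PER GAUGE-INVARIANT PIECE — an2
Lemma W: `WardIdentity.hessianAt_sum_generator_eq_zero` + criticality R4 + decay; NOT diagram by diagram)»).  The ENDs of this sub-leaf take
`hrow : ∀ κ′ λ′ b, HasSum (fineHessA A S Wf κ′ λ′ b) 0`.  The route to it from FIRST-BOND TRANSVERSALITY is two tree theorems: an2's
`KernelWard.ward_hess` — (W1) `(A ∘ divV S u) ∘ A = A ∘ X u − X u ∘ A`, (W2) `divW Wf u λ′ u′ = X u ∘ S λ′ u′ − S λ′ u′ ∘ X u` ⟹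
`Σ_{κ′} (hess A S Wf κ′ (u − e_{κ′}) λ′ u′ − hess A S Wf κ′ u λ′ u′) = 0` — read at blocking `1` through `fineHessA_eq_hess`, and an2's
`KernelRepresentationSummable.hasSum_zero_of_divFree` — a divergence-free family with absolutely summable second moments has entrywise
sum `0` (pair with the coordinate weight and telescope) — applied to the base-point kernels `t ↦ fineHessA κ′ λ′ (b + t) b`, giving the
COLUMN sums; matrix symmetry of the fine Hessian kernel turns columns into rows.

CONTENT.
* §1 [folklore] `unitVec_eq_single`; `hasSum_col_of_divFree` (any `P : EKer₂ 4` divergence-free in the first bond with `AbsMoment₂` base-point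
  kernels); `hasSum_row_of_col`.
* §2 [folklore] `divFree_fineHessA_of_wardLaws` (`ward_hess` at blocking `1`), **`hasSum_row_fineHessA_of_wardLaws`** (= `hrow`).
* §3 [folklore] **ENDs FROM SOCKETS ONLY**: `bondSecondMoment_TOfLeg_eq_avgM2_of_laws` (any leg, block-covariant data: (W1)/(W2) + relabelling
  laws) and **`bondSecondMoment_Pgh_eq_avgM2_of_laws`** (leaf-04's ghost kernel: laws for `Ggh`, `Sgh`, `ghTab`, `X`, `Φ` only).
Unit `b2b-balaban-beta-d1-formalise-leaf-01` (gen 2).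
-/

noncomputable section

namespace Summit.QuantumFields.BalabanUV.Beta.D1BFx.FineHessianWard

open Finset
open scoped BigOperators
open Literature.MathematicalPhysics.QuantumFieldTheory.Balaban1983to89
open Literature.MathematicalPhysics.QuantumFieldTheory.Balaban1983to89.Beta
open B12Sec2to5 (l1 l1_nonneg)
open B6BondElimination (unitVec unitVec_apply)
open ExpKernelCalculus (Site MKer Decays BiLoc VertexFamily VertexFamily₂ comp hess shiftK)
open DecimatedMomentSummable (AbsMoment₂)
open DressedMomentNormalisation (EKer resSite)
open MinimiserIdentityForm (wK)
open KernelReflection (LegMap refK)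
open KernelWard (divV divW ward_hess)
open KernelRepresentationSummable (hasSum_zero_of_divFree)
open Summit.QuantumFields.BalabanUV.Beta.TameKernelCalculus
open Summit.QuantumFields.BalabanUV.Beta.D1BFx.GhostLeg (Ggh spr_Ggh shiftK_Ggh_neg)
open Summit.QuantumFields.BalabanUV.Beta.D1BFx.GhostStencil (Sgh ghCnt)
open Summit.QuantumFields.BalabanUV.Beta.D1BFx.ReducedKernelF (TOfLeg)
open Summit.QuantumFields.BalabanUV.Beta.D1BFx.ReducedTableF (tableRedF)
open Summit.QuantumFields.BalabanUV.Beta.D1BFx.GhostKernel (Pgh)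
open Summit.QuantumFields.BalabanUV.Beta.D1BFx.MomentTransferPeriodic (Ker₂ baseKer)
open Summit.QuantumFields.BalabanUV.Beta.D1BFx.MomentTransferPeriodicEntry (EKer₂ avgM2)
open Summit.QuantumFields.BalabanUV.Beta.D1BFx.ReducedKernelSandwichLeg (fineHessA absMoment₂_baseKer_fineHessA fineHessA_transpose)
open Summit.QuantumFields.BalabanUV.Beta.D1BFx.ReducedKernelSandwichBlock (diagExt diagExt_symm)
open Summit.QuantumFields.BalabanUV.Beta.D1BFx.GhostKernelSandwich (ghTab fineHessGh fineHessGh_eq Pgh_eq_TOfGh_tableRedF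
  biLoc_Sgh_one biLoc_diagExt_ghTab Sgh_translate_block diagExt_ghTab_translate)
open Summit.QuantumFields.BalabanUV.Beta.D1BFx.FineHessianReflection (fineHessA_eq_hess bondSecondMoment_TOfLeg_eq_avgM2_of_refl
  bondSecondMoment_Pgh_eq_avgM2_of_refl)

/-! ## §1 Columns of a first-bond divergence-free two-point family vanish -/

/-- [folklore] The bond-elimination unit vector is Mathlib's `Pi.single μ 1`. -/
theorem unitVec_eq_single {D : ℕ} (μ : Fin D) : (unitVec μ : Fin D → ℤ) = Pi.single μ 1 := by
  funext i
  rw [unitVec_apply, Pi.single_apply]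

/-- [folklore] **COLUMN SUMS OF A FIRST-BOND DIVERGENCE-FREE FAMILY VANISH**: `P κ′ λ′ : ℤ⁴ → ℤ⁴ → ℝ` with
`Σ_{κ′} (P κ′ λ′ (u − e_{κ′}) u′ − P κ′ λ′ u u′) = 0` and absolutely summable second moments of every base-point kernel ⟹
`Σ_s P κ′ λ′ s b = 0` for every `κ′, λ′, b` (an2's `hasSum_zero_of_divFree` on `t ↦ P κ′ λ′ (b + t) b`, re-indexed). -/
theorem hasSum_col_of_divFree {P : EKer₂ 4}
    (hdiv : ∀ (l' : Fin 4) (u' u : Site 4), ∑ κ' : Fin 4, (P κ' l' (u - unitVec κ') u' - P κ' l' u u') = 0)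
    (hK : ∀ (κ' l' : Fin 4) (b : Site 4), AbsMoment₂ (baseKer (P κ' l') b)) (κ' l' : Fin 4) (b : Site 4) :
    HasSum (fun s => P κ' l' s b) 0 := by
  have hdiv' : ∀ (ν : Fin 4) (t : Site 4),
      ∑ μ : Fin 4, (baseKer (P μ ν) b t - baseKer (P μ ν) b (t - Pi.single μ 1)) = 0 := by
    intro ν t
    have h := hdiv ν b (b + t)
    rw [← neg_eq_zero, ← Finset.sum_neg_distrib] at h
    rw [← h]
    refine Finset.sum_congr rfl fun μ _ => ?_
    rw [neg_sub, baseKer, baseKer, ← unitVec_eq_single, add_sub_assoc]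
  have h0 := hasSum_zero_of_divFree (fun μ ν => baseKer (P μ ν) b) (fun μ ν => hK μ ν b) hdiv' κ' l'
  exact (Equiv.hasSum_iff (Equiv.addLeft b) (f := fun s => P κ' l' s b)).mp (h0.congr_fun fun _ => rfl)

/-- [folklore] Rows from columns for a MATRIX-SYMMETRIC family (`P κ′ λ′ u u′ = P λ′ κ′ u′ u`). -/
theorem hasSum_row_of_col {P : EKer₂ 4} (hsymm : ∀ (κ' l' : Fin 4) (u u' : Site 4), P κ' l' u u' = P l' κ' u' u)
    (hcol : ∀ (κ' l' : Fin 4) (b : Site 4), HasSum (fun s => P κ' l' s b) 0) (κ' l' : Fin 4) (b : Site 4) :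
    HasSum (P κ' l' b) 0 :=
  (hcol l' κ' b).congr_fun fun s => (hsymm l' κ' s b).symm

/-! ## §2 The fine Hessian kernel: transversality from (W1)/(W2) at blocking one, hence the Ward rows -/

variable {F : Type*} [Fintype F]
variable (A : MKer 4 F) {S : Fin 4 → Site 4 → MKer 4 F} {Wf : Fin 4 → Site 4 → Fin 4 → Site 4 → MKer 4 F} {Cs C2 Cx δ : ℝ}

/-- [folklore] **FIRST-BOND TRANSVERSALITY OF THE FINE HESSIAN KERNEL** (`KernelWard.ward_hess` at blocking `1`): a spread leg `A`,
stencils/tables bi-localised at their bonds, a gauge generator `X u` bi-localised at `(u, u)`, and the jet laws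
(W1) `(A ∘ divV S u) ∘ A = A ∘ X u − X u ∘ A`, (W2) `divW Wf u λ′ u′ = X u ∘ S λ′ u′ − S λ′ u′ ∘ X u` ⟹
`Σ_{κ′} (fineHessA κ′ λ′ (u − e_{κ′}) u′ − fineHessA κ′ λ′ u u′) = 0`. -/
theorem divFree_fineHessA_of_wardLaws (X : Site 4 → MKer 4 F) (hA : Spr A) (hS : ∀ κ' u, BiLoc (S κ' u) u u Cs δ)
    (hW : ∀ κ' u l' u', BiLoc (Wf κ' u l' u') u u' C2 δ) (hX : ∀ u, BiLoc (X u) u u Cx δ) (hδ : 0 < δ)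
    (hW1 : ∀ u, comp (comp A (divV S u)) A = comp A (X u) - comp (X u) A)
    (hW2 : ∀ (u : Site 4) (l' : Fin 4) (u' : Site 4), divW Wf u l' u' = comp (X u) (S l' u') - comp (S l' u') (X u))
    (l' : Fin 4) (u' u : Site 4) :
    ∑ κ' : Fin 4, (fineHessA A S Wf κ' l' (u - unitVec κ') u' - fineHessA A S Wf κ' l' u u') = 0 := by
  obtain ⟨CA, δA, hδA, hAd⟩ := hA
  have hm : 0 < min δA δ := lt_min hδA hδ
  have hAd' : Decays A (|CA|) (min δA δ) := decays_of_le hAd (min_le_left _ _)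
  have hV : VertexFamily S 1 (|Cs|) (min δA δ) := fun μ y => by
    simpa only [Nat.cast_one, one_smul] using biLoc_of_le (hS μ y) (min_le_right δA δ)
  have hW' : VertexFamily₂ Wf 1 (|C2|) (min δA δ) := fun μ y ν y' => by
    simpa only [Nat.cast_one, one_smul] using biLoc_of_le (hW μ y ν y') (min_le_right δA δ)
  have hX' : ∀ y : Site 4, BiLoc (X y) (((1 : ℕ) : ℤ) • y) (((1 : ℕ) : ℤ) • y) (|Cx|) (min δA δ) := fun y => by
    simpa only [Nat.cast_one, one_smul] using biLoc_of_le (hX y) (min_le_right δA δ)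
  have h := ward_hess (N := 1) X hAd' hV hW' hX' hm hW1 hW2 u l' u'
  simpa only [fineHessA_eq_hess] using h

variable [Nonempty F]

/-- [folklore] **THE WARD ROWS `hrow` OF THE FINE HESSIAN KERNEL FROM (W1)/(W2)** (plus matrix symmetry, for a SYMMETRIC table): every
entry has rows summing to zero — `∀ κ′ λ′ b, HasSum (fineHessA A S Wf κ′ λ′ b) 0`. -/
theorem hasSum_row_fineHessA_of_wardLaws (X : Site 4 → MKer 4 F) (hA : Spr A) (hS : ∀ κ' u, BiLoc (S κ' u) u u Cs δ)
    (hW : ∀ κ' u l' u', BiLoc (Wf κ' u l' u') u u' C2 δ) (hX : ∀ u, BiLoc (X u) u u Cx δ) (hδ : 0 < δ)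
    (hWsymm : ∀ (κ' : Fin 4) (u : Site 4) (l' : Fin 4) (u' : Site 4), Wf κ' u l' u' = Wf l' u' κ' u)
    (hW1 : ∀ u, comp (comp A (divV S u)) A = comp A (X u) - comp (X u) A)
    (hW2 : ∀ (u : Site 4) (l' : Fin 4) (u' : Site 4), divW Wf u l' u' = comp (X u) (S l' u') - comp (S l' u') (X u))
    (κ' l' : Fin 4) (b : Site 4) : HasSum (fineHessA A S Wf κ' l' b) 0 :=
  hasSum_row_of_col (fun κ₁ l₁ u u' => fineHessA_transpose A hA hS hδ hWsymm κ₁ l₁ u u')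
    (hasSum_col_of_divFree (divFree_fineHessA_of_wardLaws A X hA hS hW hX hδ hW1 hW2)
      (absMoment₂_baseKer_fineHessA A hA hS hW hδ)) κ' l' b

/-! ## §3 The ENDs from sockets on the primitive data only -/

variable (n : ℕ) [NeZero n]

/-- [folklore] **A4 / K-R5 OVER ANY LEG FROM SOCKETS ONLY** (block-covariant data): leg spread, block covariant and fixed by the relabelling
`Φ`; stencils/tables bi-localised, block covariant, table symmetric; gauge generator `X` with (W1)/(W2); inversion-type relabelling laws
with equal bond signs ⟹ `Σ′_z z_κ z_λ · n⁸ · TOfLeg n A S (tableRedF n Wf) μ ν z = avgM2 n (fineHessA A S Wf μ ν) κ λ` — NO hypothesis on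
the composite kernel remains. -/
theorem bondSecondMoment_TOfLeg_eq_avgM2_of_laws (hA : Spr A) (hAcov : ∀ t : Site 4, shiftK (-((n : ℤ) • t)) A = A)
    (hS : ∀ κ' u, BiLoc (S κ' u) u u Cs δ) (hW : ∀ κ' u l' u', BiLoc (Wf κ' u l' u') u u' C2 δ) (hδ : 0 < δ)
    (hScov : ∀ (κ' : Fin 4) (u t : Site 4), S κ' (u + (n : ℤ) • t) = shiftK (-((n : ℤ) • t)) (S κ' u))
    (hWcov : ∀ (κ' : Fin 4) (u : Site 4) (l' : Fin 4) (u' t : Site 4),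
      Wf κ' (u + (n : ℤ) • t) l' (u' + (n : ℤ) • t) = shiftK (-((n : ℤ) • t)) (Wf κ' u l' u'))
    (hWsymm : ∀ (κ' : Fin 4) (u : Site 4) (l' : Fin 4) (u' : Site 4), Wf κ' u l' u' = Wf l' u' κ' u)
    (X : Site 4 → MKer 4 F) (hX : ∀ u, BiLoc (X u) u u Cx δ)
    (hW1 : ∀ u, comp (comp A (divV S u)) A = comp A (X u) - comp (X u) A)
    (hW2 : ∀ (u : Site 4) (l' : Fin 4) (u' : Site 4), divW Wf u l' u' = comp (X u) (S l' u') - comp (S l' u') (X u))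
    (Φ : LegMap 4 F) (hAr : refK Φ A = A) (a : Fin 4 → Site 4) (σ : Fin 4 → ℝ) (hσ : ∀ κ' l' : Fin 4, σ κ' * σ l' = 1)
    (hSr : ∀ κ' u, S κ' (a κ' - u) = σ κ' • refK Φ (S κ' u))
    (hWr : ∀ κ' u l' u', Wf κ' (a κ' - u) l' (a l' - u') = (σ κ' * σ l') • refK Φ (Wf κ' u l' u'))
    (κ lam μ ν : Fin 4) :
    ∑' z : Site 4, ((z κ * z lam : ℤ) : ℝ) * ((n : ℝ) ^ 8 * TOfLeg n A S (tableRedF n Wf) μ ν z)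
      = avgM2 n (fineHessA A S Wf μ ν) κ lam :=
  bondSecondMoment_TOfLeg_eq_avgM2_of_refl A n hA hAcov hS hW hδ hScov hWcov hWsymm
    (hasSum_row_fineHessA_of_wardLaws A X hA hS hW hX hδ hWsymm hW1 hW2) Φ hAr a σ hσ hSr hWr κ lam μ ν

/-- [folklore] **A4 / K-R5 FOR LEAF-04's GHOST KERNEL FROM SOCKETS ONLY** (`0 < a`): a gauge generator `X u` (bi-localised at `(u,u)`, rate `1/n`)
with the jet laws (W1) for `(Ggh n a, Sgh n cK cQ)` and (W2) for the diagonal contact table `diagExt (ghTab cW)`, and an inversion-type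
relabelling `Φ` fixing `Ggh n a` under which `Sgh` picks up equal bond signs and `ghTab` is invariant ⟹
`Σ′_z z_κ z_λ · n⁸ · Pgh n a cK cQ cW μ ν z = avgM2 n (fineHessGh n a cK cQ cW μ ν) κ λ` — NO hypothesis on the composite kernel remains. -/
theorem bondSecondMoment_Pgh_eq_avgM2_of_laws (a cK cQ cW : ℝ) (ha : 0 < a) {Cx : ℝ}
    (X : Site 4 → MKer 4 Unit) (hX : ∀ u, BiLoc (X u) u u Cx (1 / n))
    (hW1 : ∀ u, comp (comp (Ggh n a) (divV (Sgh n cK cQ) u)) (Ggh n a) = comp (Ggh n a) (X u) - comp (X u) (Ggh n a))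
    (hW2 : ∀ (u : Site 4) (l' : Fin 4) (u' : Site 4),
      divW (diagExt (ghTab cW)) u l' u' = comp (X u) (Sgh n cK cQ l' u') - comp (Sgh n cK cQ l' u') (X u))
    (Φ : LegMap 4 Unit) (hAr : refK Φ (Ggh n a) = Ggh n a) (c : Fin 4 → Site 4) (σ : Fin 4 → ℝ)
    (hσ : ∀ κ' l' : Fin 4, σ κ' * σ l' = 1)
    (hSr : ∀ κ' u, Sgh n cK cQ κ' (c κ' - u) = σ κ' • refK Φ (Sgh n cK cQ κ' u))
    (hTr : ∀ κ' u, ghTab cW κ' (c κ' - u) = refK Φ (ghTab cW κ' u))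
    (κ lam μ ν : Fin 4) :
    ∑' z : Site 4, ((z κ * z lam : ℤ) : ℝ) * ((n : ℝ) ^ 8 * Pgh n a cK cQ cW μ ν z)
      = avgM2 n (fineHessGh n a cK cQ cW μ ν) κ lam := by
  have hn : (0 : ℝ) < 1 / (n : ℝ) := div_pos one_pos (by exact_mod_cast Nat.pos_of_ne_zero (NeZero.ne n))
  have hrow : ∀ (κ' l' : Fin 4) (b : Site 4), HasSum (fineHessGh n a cK cQ cW κ' l' b) 0 := fun κ' l' b => by
    rw [fineHessGh_eq]
    exact hasSum_row_fineHessA_of_wardLaws (Ggh n a) X (spr_Ggh n a ha) (biLoc_Sgh_one n cK cQ) (biLoc_diagExt_ghTab n cW) hX hn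
      (fun κ₁ u l₁ u' => diagExt_symm (ghTab cW) κ₁ u l₁ u') hW1 hW2 κ' l' b
  exact bondSecondMoment_Pgh_eq_avgM2_of_refl n a cK cQ cW ha hrow Φ hAr c σ hσ hSr hTr κ lam μ ν

end Summit.QuantumFields.BalabanUV.Beta.D1BFx.FineHessianWard

end
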